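import Literature.MathematicalPhysics.QuantumFieldTheory.Balaban1983to89.B9Eq3131Pointwise
import Literature.MathematicalPhysics.QuantumFieldTheory.Balaban1983to89.B9SectDSup
import Literature.MathematicalPhysics.QuantumFieldTheory.Balaban1983to89.B9SectCDiffFrame

/-!
# `Balaban1983to89.B9Ineq3131Assembly` — B9 p. 422, inequality (3.131): the BOOKKEEPING half — the printed
# L¹ × sup bound on `⟨A₁, Δ′_πA₂⟩` ASSEMBLED from the pointwise majorization (`B9Eq3131Pointwise`) and the inputs the
# paper names (Theorem 3.1 with (3.49), the regularity condition (3.36), the p. 398 scale-transfer remark = [4] (2.60),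
# and [4] (2.54) + Lemma 2.1 (2.61)), over a block map of the exact-background lattice into the multiscale geometry 𝔅

statement-level skeleton of published theorems with citation tags; proofs where landed; nothing here is a claim about the Yang–Mills mass gap

T. Bałaban, *Propagators for lattice gauge theories in a background field*, Commun. Math. Phys. **99** (1985) 389–434
[Balaban1985BackgroundPropagators] (cell paper B9; PDF held `paper:balaban1985-cmp99-background-propagators`, journal page = PDF page
+ 388; pp. 396–399, 421–422 = renders `…-p008…p011-x2.png`, `…-p033-x2.png`, `…-p034-x2.png`, READ AS IMAGES by this seat,
2026-08-21), and T. Bałaban, *Propagators and renormalization transformations for lattice gauge theories. II*, Commun. Math. Phys.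
**96** (1984) 223–250 [Balaban1984PropagatorsII] (= ref. [4] of B9), Lemma 2.1 p. 234.
Cell `lit-balaban`, SKELETON row **B9.Eq3.130** (= (3.130)–(3.131)), the (3.131) member; reader/typer seat r06 (B9 block owner),
gen 3.  Referee ref-4.  Cell GAPS G-B9-16 (the (3.131) bookkeeping) is what this file closes at the level stated below.

CITATION HEADER / WHAT IS IN PRINT.  p. 421: *"It is easy to find estimates for the operator Δ′_π, using Theorem 3.1 and the
inequality (3.49), we have to be careful only with the third term in the definition (3.120) of Δ′_π. One of the three derivatives
there has to be applied either to an expression on the right, or on the left, of Δ′_π. For example one of the terms in ⟨A₁,Δ′_πA₂⟩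
is ½⟨i[(DG′RD*A₁)(b), (G′RD*A₂)(b₋)], J⟩, and we apply the derivative D* to A₁. We have"* p. 422: *"|⟨A₁Δ′_πA₂⟩| ≦
O(1)Mα₀(‖D*A₁‖_{L¹} + (L^jη)^{−1}‖A₁‖_{L¹})e^{−(1/2)δ₀d(y,y′)}(|D*A₂| + (L^{j′}η)^{−1}|A₂|) for supp A₁ ⊂ Δ(y), y ∈ Λ_j,
supp A₂ ⊂ Δ(y′), y′ ∈ Λ_{j′}. (3.131)"*.  The inputs named there, as printed: Theorem 3.1 (3.42) p. 397 *"|(G′(U)λ)(x)|,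
|(∇_UG′(U)λ)(x)|, |(G′(U)∇*_Uλ)(x)|, |(Δ_UG′(U)λ)(x)| ≦ B₀[(L^jη)², L^jη, L^jη, 1]e^{−δ₀d(y,y′)}|λ| for x ∈ Δ(y), y ∈ Λ_j,
supp λ ⊂ Δ(y′)"*; (3.49) p. 399 *"[|P(x,x′)|, |(DP)_μ(x,x′)|, |(PD*)_ν(x,x′)|, |(DPD*)_{μν}(x,x′)|] ≦ O(1)[1,(L^jη)^{−1},(L^jη)^{−1},
(L^jη)^{−2}](L^{j′}η)^{−d}e^{−(1/2)δ₀d(y,y′)} for x ∈ Δ(y), y ∈ Λ_j, x′ ∈ Δ(y′), y′ ∈ Λ_{j′}"* (P = I − R); (3.36) p. 396 *"|∂^{η*}∂^ηA|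
< O(1)Mα₀(L^jη)^{−3} on □"* (used on p. 422 in the form *"|(H*J)(b)| ≦ O(1)Mα₀(L^jη)^{−3} for b ∈ Λ_j"*); the remark p. 398
*"the choice of powers L^jη is conventional also. Using Lemma 2.1 in [4] we may replace the factor (L^jη)^α by (L^jη)^β(L^{j′}η)^γ
with β + γ = α, j, j′ are indices of localizations"*; [4] (2.54) (triangle inequality for d), Lemma 2.1 (2.60)–(2.61) p. 234.

WHAT THIS FILE PROVES (0 sorry; NO new `def … : Prop`; defs WITH bodies: the norms of (3.39) and of (3.131)).
* §1 the printed norms over a BLOCK MAP `blk : S → 𝔅` of the exact-background lattice `(S, ι, T, U)` of `B9Eq39Adjoint` into the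
  coarse sites 𝔅 = `g.Site` of a `B6.Geometry` (`blk x = y` ⟺ x ∈ Δ(y)): sup norms `ssup`/`bsup` (3.39), L¹ norms `sl1`/`bl1` (η^d Σ|·|,
  the `‖·‖_{L¹}` of (3.131)) and their block parts `sl1On`/`bl1On`; the η-scaled covariant divergence `divBη` (D^{η*}_U of (3.8)) used
  to DISPLAY `‖D*A₁‖_{L¹}`, `|D*A₂|`; elementary API (non-negativity, `norm_le_bsup`, the fiber decomposition `sum_mul_eq_sum_fiber`).
* §2 the pure bookkeeping lemmas (real-valued): the two *supported-factor* terms (`term_supp_le`, `term_supp_le'`) and the two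
  *spread* terms carrying one derivative each (`term_fiber_le`, `term_fiber_le'`) of the six products of the majorization; the
  scale transfer of the p. 398 remark in the two powers (L^jη)¹, (L^jη)² that occur (`len_le_transfer`, `len_sq_le_transfer`, from
  [4] (2.60) = `B6RandomWalk.Ineq260` via `B9SectDL2Decay.len_pow_le_of_ineq260`, under 2·log L ≦ αδ₀RM and the symmetry of d);
  the two convolution estimates (`conv_sq_le`, `conv_lin_le`, from [4] (2.54) + (2.61) = `B11SectG.conv_exp_le`).
* §3 **`ineq3131_assembled`**: for bond functions A₁ ⊂ Δ(y), A₂ ⊂ Δ(y′) (support hypotheses), a unit-bounded background, a bounded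
  trace functional and η > 0, FROM (i) the landed pointwise majorization `B9Eq3131Pointwise.norm_deltaPiPrimeBil_le`, (ii) the bound
  `|J(b)| ≦ c_J·Mα₀·(L^{j(b)}η)^{−3}` ((3.36) in the form used on p. 422), (iii) for λ₂ = 𝒫A₂ (𝒫 = G′RD* of the print, kept abstract)
  the SUP entries of (3.42)₁,₂ ∘ (3.49) at rate δ_P with a common size factor n₂ (read n₂ = |D*A₂|), over each cube Δ(y″) AND its unit
  translates T_μΔ(y″) ⊂ Δ̃(y″), (iv) for λ₁ = 𝒫A₁ the L¹ (dual) entries of (3.42)₁,₃ ∘ (3.49) at rate δ_P with size factor m₁ (read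
  m₁ = ‖D*A₁‖_{L¹}), over the same cubes, (v) the geometry of 𝔅: d ≧ 0 symmetric with (2.54), the row sum (2.61) at rate σ with
  constant c, (2.60) at rate αδ₀ with 2 log L ≦ αδ₀RM, L ≧ 1, η > 0 — the bound
  `|⟨A₁,Δ′_πA₂⟩| ≦ O₁·Mα₀·(m₁ + (L^jη)^{−1}‖A₁‖_{L¹})·e^{−ρd(y,y′)}·(n₂ + (L^{j′}η)^{−1}|A₂|)` for every rate ρ ≧ 0 with
  ρ + σ + αδ₀ ≦ δ_P, with the EXPLICIT constant `O1 ‖τ‖ c_J C_P |ι| L c = ‖τ‖c_JC_P(2 + 2|ι|L² + C_Pc(|ι|L² + L))`.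
  Term by term (the print's instruction, now kernel-checked): the two products with A₁ un-differentiated give (L^jη)^{−1}‖A₁‖_{L¹}·n₂
  with no block sum; the two with A₂ un-differentiated give m₁·(L^{j′}η)^{−1}|A₂| after ONE transfer (L^jη)² → (L^{j′}η)²; the two
  third-term products — *"one of the three derivatives … applied either to an expression on the right, or on the left"* — give m₁·n₂
  after a transfer and ONE convolution over the intermediate block; the fourth cross product (L^jη)^{−1}‖A₁‖(L^{j′}η)^{−1}|A₂| of the
  printed right-hand side is not produced by any term (the printed product form is an upper bound of the sum of the three).
* §4 **`ineq3131_printed`** — (3.131) LETTER FOR LETTER: δ_P = δ₀ (the rate of Theorem 3.1), ρ = ½δ₀, m₁ = ‖D*A₁‖_{L¹} =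
  `sl1 η d (divBη A₁)`, n₂ = |D*A₂| = `ssup (divBη A₂)`, |A₂| = `bsup A₂`, under σ + αδ₀ ≦ ½δ₀.
NOT REPRODUCED (said once; this is exactly where the tree stands): Theorem 3.1 and (3.49) themselves (statement rows `B9.Thm31Printed`,
typed-existing; here their COMPOSITES for 𝒫 = G′RD* are hypotheses of the printed shape — the L¹ entries are the duals of the printed
sup entries for the symmetric kernel G′, and the cubes are read as Δ(y″) together with their unit translates, both inside the
Δ̃(y″) of (3.44)–(3.45): the passage costs an O(1) = O(d, L) by (2.2) and is geometry not modelled here); the derivation of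
|J| ≦ O(1)Mα₀(L^jη)^{−3} from (3.36) (perturbative algebra in the local axial gauge); the rate loss hidden in the print's O(1)-convention
for exponents (the (3.49) tail of R decays at ½δ₀, so the literal δ_P of (iii)–(iv) is ½δ₀ — composing G′ with that tail by (2.54) + (2.61) keeps
½δ₀, the row sum being spent on the δ₀ factor — and the honest ρ of (3.131) is then ½δ₀ − αδ₀ − σ after the one transfer and the one convolution
spent HERE; the paper re-defines δ₀, B₀ as common best constants on pp. 423–424, cell DIVERGENCE D-r1.2, and the cell record of this point is
GAPS G-B9-r06-2 — the general-rate theorem `ineq3131_assembled` is the statement that survives this, `ineq3131_printed` displays the printed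
letters under the printed reading δ_P = δ₀).  Value = kernel-checked bookkeeping of a printed "it is easy to find estimates" with every
constant explicit; NOT summit progress.

v2 (re-file of p246667, which bounced on `dedup.landed` only: the public helper `len_pos` restated `B9SectCDiffFrame.len_pos` — now
imported and reused; r06 g3): also the rate sentence above and the `ineq3131_printed` docstring give the exact accounting (literal input
rate ½δ₀ from (3.49); loss αδ₀ + σ spent in this file), cell GAPS G-B9-r06-2; no other declaration changed.
-/

noncomputable section

namespace Literature.MathematicalPhysics.QuantumFieldTheory.Balaban1983to89.B9Ineq3131Assembly

open Literature.MathematicalPhysics.QuantumFieldTheory.Balaban1983to89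
open Literature.MathematicalPhysics.QuantumFieldTheory.Balaban1983to89.B9Eq39Adjoint (J divB)
open Literature.MathematicalPhysics.QuantumFieldTheory.Balaban1983to89.B9Eq3117Current (covDη)
open Literature.MathematicalPhysics.QuantumFieldTheory.Balaban1983to89.B9Eq3131Pointwise (deltaPiPrimeBil
  norm_deltaPiPrimeBil_le)
open Literature.MathematicalPhysics.QuantumFieldTheory.Balaban1983to89.B6RandomWalk (Triangle254 Ineq260)
open Literature.MathematicalPhysics.QuantumFieldTheory.Balaban1983to89.B11SectG (RowSum conv_exp_le)
open Literature.MathematicalPhysics.QuantumFieldTheory.Balaban1983to89.B9SectDSup (DistSymm)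
open Literature.MathematicalPhysics.QuantumFieldTheory.Balaban1983to89.B9SectCDiffFrame (len_pos)

/-! ## §1 The norms of (3.39) and (3.131) over a block map, and the η-scaled divergence -/

section Norms

variable {𝔸 : Type*} [NormedRing 𝔸]
variable {S : Type*} [Fintype S] {ι : Type*} [Fintype ι] {Y : Type*} [Fintype Y]

/-- The sup norm `|λ| = sup_x |λ(x)|` of a site function ((3.39) for functions on sites).
[cite: Balaban1985BackgroundPropagators, (3.39) p.397] -/
def ssup (f : S → 𝔸) : ℝ := ⨆ x, ‖f x‖

/-- The sup norm `|A| = max_μ sup_x |A_μ(x)|` of a bond function, (3.39). [cite: Balaban1985BackgroundPropagators, (3.39) p.397] -/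
def bsup (A : ι → S → 𝔸) : ℝ := ⨆ b : ι × S, ‖A b.1 b.2‖

/-- The L¹ norm `‖λ‖_{L¹} = η^d Σ_x |λ(x)|` of a site function on the η-lattice (the `‖D*A₁‖_{L¹}` of (3.131)).
[cite: Balaban1985BackgroundPropagators, (3.131) p.422] -/
def sl1 (η : ℝ) (d : ℕ) (f : S → 𝔸) : ℝ := η ^ d * ∑ x, ‖f x‖

/-- The L¹ norm `‖A‖_{L¹} = η^d Σ_b |A(b)|` of a bond function on the η-lattice (the `‖A₁‖_{L¹}` of (3.131)).
[cite: Balaban1985BackgroundPropagators, (3.131) p.422] -/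
def bl1 (η : ℝ) (d : ℕ) (A : ι → S → 𝔸) : ℝ := η ^ d * ∑ x, ∑ μ, ‖A μ x‖

variable (blk : S → Y)

open Classical in
/-- The L¹ norm of a site function over ONE cube Δ(y) = `blk⁻¹ y` of the localization (p. 397: *"if y ∈ Λ_j, then Δ(y) = B^j(y)"*):
`η^d Σ_{x ∈ Δ(y)} |λ(x)|`. [cite: Balaban1985BackgroundPropagators, p.397 + (3.131) p.422] -/
def sl1On (η : ℝ) (d : ℕ) (y : Y) (f : S → 𝔸) : ℝ := η ^ d * ∑ x, if blk x = y then ‖f x‖ else 0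

open Classical in
/-- The L¹ norm of a bond function over the bonds based in ONE cube Δ(y): `η^d Σ_{b ∈ Δ(y)} |A(b)|`.
[cite: Balaban1985BackgroundPropagators, p.397 + (3.131) p.422] -/
def bl1On (η : ℝ) (d : ℕ) (y : Y) (A : ι → S → 𝔸) : ℝ := η ^ d * ∑ x, if blk x = y then ∑ μ, ‖A μ x‖ else 0

open Classical in
omit [Fintype Y] in
/-- `sl1On` unfolded. [cite: Balaban1985BackgroundPropagators, (3.131) p.422] -/
theorem sl1On_def (η : ℝ) (d : ℕ) (y : Y) (f : S → 𝔸) :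
    sl1On blk η d y f = η ^ d * ∑ x, if blk x = y then ‖f x‖ else 0 := rfl

open Classical in
omit [Fintype Y] in
/-- `bl1On` unfolded. [cite: Balaban1985BackgroundPropagators, (3.131) p.422] -/
theorem bl1On_def (η : ℝ) (d : ℕ) (y : Y) (A : ι → S → 𝔸) :
    bl1On blk η d y A = η ^ d * ∑ x, if blk x = y then ∑ μ, ‖A μ x‖ else 0 := rfl

omit [Fintype ι] in
/-- `|λ(x)| ≦ |λ|`. [cite: Balaban1985BackgroundPropagators, (3.39) p.397] -/
theorem norm_le_ssup (f : S → 𝔸) (x : S) : ‖f x‖ ≤ ssup f :=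
  le_ciSup (f := fun x => ‖f x‖) (Set.finite_range _).bddAbove x

omit [Fintype S] [Fintype ι] in
/-- `0 ≦ |λ|`. [cite: Balaban1985BackgroundPropagators, (3.39) p.397] -/
theorem ssup_nonneg (f : S → 𝔸) : 0 ≤ ssup f := Real.iSup_nonneg fun _ => norm_nonneg _

/-- `|A_μ(x)| ≦ |A|`. [cite: Balaban1985BackgroundPropagators, (3.39) p.397] -/
theorem norm_le_bsup (A : ι → S → 𝔸) (μ : ι) (x : S) : ‖A μ x‖ ≤ bsup A :=
  le_ciSup (f := fun b : ι × S => ‖A b.1 b.2‖) (Set.finite_range _).bddAbove (μ, x)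

omit [Fintype S] [Fintype ι] in
/-- `0 ≦ |A|`. [cite: Balaban1985BackgroundPropagators, (3.39) p.397] -/
theorem bsup_nonneg (A : ι → S → 𝔸) : 0 ≤ bsup A := Real.iSup_nonneg fun _ => norm_nonneg _

omit [Fintype ι] in
/-- `0 ≦ ‖λ‖_{L¹}` for `η ≧ 0`. [cite: Balaban1985BackgroundPropagators, (3.131) p.422] -/
theorem sl1_nonneg {η : ℝ} (hη : 0 ≤ η) (d : ℕ) (f : S → 𝔸) : 0 ≤ sl1 η d f :=
  mul_nonneg (pow_nonneg hη d) (Finset.sum_nonneg fun _ _ => norm_nonneg _)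

/-- `0 ≦ ‖A‖_{L¹}` for `η ≧ 0`. [cite: Balaban1985BackgroundPropagators, (3.131) p.422] -/
theorem bl1_nonneg {η : ℝ} (hη : 0 ≤ η) (d : ℕ) (A : ι → S → 𝔸) : 0 ≤ bl1 η d A :=
  mul_nonneg (pow_nonneg hη d) (Finset.sum_nonneg fun _ _ => Finset.sum_nonneg fun _ _ => norm_nonneg _)

open Classical in
omit [Fintype ι] in
/-- **Fiber decomposition of a lattice sum over the cubes**: `Σ_x F(y_x)·G(x) = Σ_{y ∈ 𝔅} F(y)·Σ_{x ∈ Δ(y)} G(x)` — how a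
sum over all bonds is organised block by block before Lemma 2.1 of [4] is applied.
[cite: Balaban1985BackgroundPropagators, p.397; Balaban1984PropagatorsII, Lemma 2.1 p.234] -/
theorem sum_mul_eq_sum_fiber (F : Y → ℝ) (G : S → ℝ) :
    ∑ x, F (blk x) * G x = ∑ y, F y * ∑ x, (if blk x = y then G x else 0) := by
  classical
  have h : ∀ y, F y * ∑ x, (if blk x = y then G x else 0) = ∑ x, (if blk x = y then F y * G x else 0) := by
    intro y
    rw [Finset.mul_sum]
    refine Finset.sum_congr rfl fun x _ => ?_
    split_ifs <;> simp
  simp_rw [h]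
  rw [Finset.sum_comm]
  refine Finset.sum_congr rfl fun x _ => ?_
  rw [Finset.sum_ite_eq]
  simp

end Norms

section Divergence

variable {𝔸 : Type*} [Ring 𝔸] [Algebra ℂ 𝔸] {S : Type*} {ι : Type*} [Fintype ι]
variable (T : ι → Equiv.Perm S) (U : ι → S → 𝔸ˣ)

/-- The η-scaled covariant divergence `D* = D^{η*}_U`: `(D*A)(x) = η⁻¹ Σ_μ [R(U⁻¹)A_μ(x − e_μ) − A_μ(x)]`, i.e. `η⁻¹·divB` of
`B9Eq39Adjoint` ((3.8); the tree writes this inline elsewhere). [cite: Balaban1985BackgroundPropagators, (3.8) p.392] -/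
def divBη (η : ℝ) (A : ι → S → 𝔸) : S → 𝔸 := fun x => ((η : ℂ)⁻¹) • divB T U A x

/-- `divBη` unfolded. [cite: Balaban1985BackgroundPropagators, (3.8) p.392] -/
theorem divBη_apply (η : ℝ) (A : ι → S → 𝔸) (x : S) : divBη T U η A x = ((η : ℂ)⁻¹) • divB T U A x := rfl

end Divergence

/-! ## §2 Pure bookkeeping: the four term shapes, the scale transfer, the two convolutions -/

section Terms

variable {S : Type*} [Fintype S] {ι : Type*} [Fintype ι] {Y : Type*} [Fintype Y] (blk : S → Y)

omit [Fintype Y] in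
/-- **Supported-factor term, summed factor un-localized** (the shape of `Σ_b |J(b)||λ₂(b∓)||A₁(b)|`): if `a` vanishes off Δ(y),
`a ≧ 0` and `w·l ≦ K` on Δ(y), then `Σ_x Σ_μ w·l·a ≦ K·Σ_x Σ_μ a`. [cite: Balaban1985BackgroundPropagators, (3.131) p.422] -/
theorem term_supp_le {w l a : ι → S → ℝ} {y : Y} {K : ℝ} (ha0 : ∀ μ x, 0 ≤ a μ x)
    (hsupp : ∀ μ x, blk x ≠ y → a μ x = 0) (hK : ∀ μ x, blk x = y → w μ x * l μ x ≤ K) :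
    ∑ x, ∑ μ, w μ x * l μ x * a μ x ≤ K * ∑ x, ∑ μ, a μ x := by
  rw [Finset.mul_sum]
  refine Finset.sum_le_sum fun x _ => ?_
  rw [Finset.mul_sum]
  refine Finset.sum_le_sum fun μ _ => ?_
  by_cases hx : blk x = y
  · exact mul_le_mul_of_nonneg_right (hK μ x hx) (ha0 μ x)
  · rw [hsupp μ x hx, mul_zero, mul_zero]

open Classical in
omit [Fintype Y] in
/-- **Supported-factor term, summed factor localized to the cube** (the shape of `Σ_b |J(b)||λ₁(b∓)||A₂(b)|`): if `a` vanishes off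
Δ(y′), `l ≧ 0` and `w·a ≦ K` on Δ(y′) with `K ≧ 0`, then `Σ_x Σ_μ w·l·a ≦ K·Σ_x Σ_μ 1_{Δ(y′)}(x)·l`.
[cite: Balaban1985BackgroundPropagators, (3.131) p.422] -/
theorem term_supp_le' {w l a : ι → S → ℝ} {y : Y} {K : ℝ} (hl0 : ∀ μ x, 0 ≤ l μ x)
    (hsupp : ∀ μ x, blk x ≠ y → a μ x = 0) (hK : ∀ μ x, blk x = y → w μ x * a μ x ≤ K) :
    ∑ x, ∑ μ, w μ x * l μ x * a μ x ≤ K * ∑ x, ∑ μ, (if blk x = y then l μ x else 0) := by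
  rw [Finset.mul_sum]
  refine Finset.sum_le_sum fun x _ => ?_
  rw [Finset.mul_sum]
  refine Finset.sum_le_sum fun μ _ => ?_
  by_cases hx : blk x = y
  · rw [if_pos hx, show w μ x * l μ x * a μ x = w μ x * a μ x * l μ x by ring]
    exact mul_le_mul_of_nonneg_right (hK μ x hx) (hl0 μ x)
  · rw [hsupp μ x hx, mul_zero, if_neg hx, mul_zero]

open Classical in
/-- **Spread term, derivative on the right factor** (the shape of `Σ_b |J(b)||λ₁(b₋)||(Dλ₂)(b)|`): if `l ≧ 0` and
`w(b)·m(b) ≦ F(y_b)` then `Σ_x Σ_μ w·l·m ≦ |ι|·Σ_{y″} F(y″)·Σ_{x ∈ Δ(y″)} l(x)` — the sum organised over the intermediate cube.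
[cite: Balaban1985BackgroundPropagators, (3.131) p.422] -/
theorem term_fiber_le {w m : ι → S → ℝ} {l : S → ℝ} {F : Y → ℝ} (hl0 : ∀ x, 0 ≤ l x)
    (hF : ∀ μ x, w μ x * m μ x ≤ F (blk x)) :
    ∑ x, ∑ μ, w μ x * l x * m μ x ≤ Fintype.card ι * ∑ y, F y * ∑ x, (if blk x = y then l x else 0) := by
  rw [← sum_mul_eq_sum_fiber blk F l, Finset.mul_sum]
  refine Finset.sum_le_sum fun x _ => ?_
  calc ∑ μ, w μ x * l x * m μ x = ∑ μ, w μ x * m μ x * l x := Finset.sum_congr rfl fun μ _ => by ring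
    _ ≤ ∑ _μ : ι, F (blk x) * l x := Finset.sum_le_sum fun μ _ => mul_le_mul_of_nonneg_right (hF μ x) (hl0 x)
    _ = Fintype.card ι * (F (blk x) * l x) := by rw [Finset.sum_const, nsmul_eq_mul, Finset.card_univ]

open Classical in
/-- **Spread term, derivative on the left factor** (the shape of `Σ_b |J(b)||λ₂(b₋)||(Dλ₁)(b)|`): if `m ≧ 0` and `w(b)·l(b₋) ≦ F(y_b)`
then `Σ_x Σ_μ w·l·m ≦ Σ_{y″} F(y″)·Σ_{x ∈ Δ(y″)} Σ_μ m_μ(x)`. [cite: Balaban1985BackgroundPropagators, (3.131) p.422] -/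
theorem term_fiber_le' {w m : ι → S → ℝ} {l : S → ℝ} {F : Y → ℝ} (hm0 : ∀ μ x, 0 ≤ m μ x)
    (hF : ∀ μ x, w μ x * l x ≤ F (blk x)) :
    ∑ x, ∑ μ, w μ x * l x * m μ x ≤ ∑ y, F y * ∑ x, (if blk x = y then ∑ μ, m μ x else 0) := by
  rw [← sum_mul_eq_sum_fiber blk F (fun x => ∑ μ, m μ x)]
  refine Finset.sum_le_sum fun x _ => ?_
  rw [Finset.mul_sum]
  exact Finset.sum_le_sum fun μ _ => mul_le_mul_of_nonneg_right (hF μ x) (hm0 μ x)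

end Terms

section Rates

variable {g : B6.Geometry}

/-- **The scale transfer of p. 398, power 1**: `L^jη ≦ L·(L^{j″}η)·e^{αδ₀d(y,y″)}` from [4] (2.60) under `2·log L ≦ αδ₀RM`
(the power-2 largeness also serves power 1 since `log L ≧ 0`) and the symmetry of d.
[cite: Balaban1985BackgroundPropagators, p.398 (remark after (3.47)); Balaban1984PropagatorsII, Lemma 2.1 (2.60) p.234] -/
theorem len_le_transfer {δ₀ α : ℝ} (h260 : Ineq260 g δ₀ α) (hαδ : 0 ≤ α * δ₀) (hd : ∀ a b : g.Site, 0 ≤ g.dist a b)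
    (hsym : DistSymm g) (hL : 1 ≤ g.L) (hη : 0 ≤ g.eta) (hRM : 2 * Real.log g.L ≤ α * δ₀ * g.R * g.M)
    (y y'' : g.Site) : g.len y ≤ g.L * g.len y'' * Real.exp (α * δ₀ * g.dist y y'') := by
  have hlog : 0 ≤ Real.log g.L := Real.log_nonneg hL
  have hRM1 : ((1 : ℕ) : ℝ) * Real.log g.L ≤ α * δ₀ * g.R * g.M := by push_cast; linarith
  have h := B9SectDL2Decay.len_pow_le_of_ineq260 h260 hαδ hd hL hη 1 hRM1 y'' y
  rw [pow_one, pow_one, pow_one, hsym y'' y] at h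
  exact h

/-- **The scale transfer of p. 398, power 2**: `(L^jη)² ≦ L²·(L^{j″}η)²·e^{αδ₀d(y,y″)}` from [4] (2.60) under `2·log L ≦ αδ₀RM` and
the symmetry of d. [cite: Balaban1985BackgroundPropagators, p.398 (remark after (3.47)); Balaban1984PropagatorsII, Lemma 2.1 (2.60) p.234] -/
theorem len_sq_le_transfer {δ₀ α : ℝ} (h260 : Ineq260 g δ₀ α) (hαδ : 0 ≤ α * δ₀) (hd : ∀ a b : g.Site, 0 ≤ g.dist a b)
    (hsym : DistSymm g) (hL : 1 ≤ g.L) (hη : 0 ≤ g.eta) (hRM : 2 * Real.log g.L ≤ α * δ₀ * g.R * g.M)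
    (y y'' : g.Site) : g.len y ^ 2 ≤ g.L ^ 2 * g.len y'' ^ 2 * Real.exp (α * δ₀ * g.dist y y'') := by
  have hRM2 : ((2 : ℕ) : ℝ) * Real.log g.L ≤ α * δ₀ * g.R * g.M := by push_cast; linarith
  have h := B9SectDL2Decay.len_pow_le_of_ineq260 h260 hαδ hd hL hη 2 hRM2 y'' y
  rw [hsym y'' y] at h
  exact h

/-- Merging the transfer factor into an exponential: `e^{αδ₀d}·e^{−δ_Pd} = e^{−(δ_P − αδ₀)d}` (arithmetic; private plumbing). [folklore] -/
private theorem exp_transfer_mul (a δP t : ℝ) :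
    Real.exp (a * t) * Real.exp (-(δP * t)) = Real.exp (-((δP - a) * t)) := by
  rw [← Real.exp_add]; congr 1; ring

/-- Rates only improve: `e^{−δ_Pd} ≦ e^{−ρd}` for `ρ ≦ δ_P`, `d ≧ 0` (arithmetic; private plumbing). [folklore] -/
private theorem exp_rate_mono {ρ δP t : ℝ} (hρ : ρ ≤ δP) (ht : 0 ≤ t) :
    Real.exp (-(δP * t)) ≤ Real.exp (-(ρ * t)) :=
  Real.exp_le_exp.mpr (by nlinarith)

/-- **Convolution for the power-2 spread term** (T5 of §3): with the transfer (2.60) and the row sum (2.61) at rate σ,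
`Σ_{y″} (L^{j″}η)^{−2}e^{−δ_Pd(y″,y′)}·[(L^jη)²e^{−δ_Pd(y,y″)}] ≦ L²·c·e^{−ρd(y,y′)}` whenever `0 ≦ ρ`, `ρ + σ + αδ₀ ≦ δ_P`.
[cite: Balaban1985BackgroundPropagators, (3.131) p.422 + p.398; Balaban1984PropagatorsII, (2.54) p.233, Lemma 2.1 (2.60)–(2.61) p.234] -/
theorem conv_sq_le {δ₀ α σ c δP ρ : ℝ} (h260 : Ineq260 g δ₀ α) (hαδ : 0 ≤ α * δ₀)
    (hd : ∀ a b : g.Site, 0 ≤ g.dist a b) (hsym : DistSymm g) (htri : Triangle254 g) (hrow : RowSum g σ c)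
    (hL : 1 ≤ g.L) (hη : 0 < g.eta) (hRM : 2 * Real.log g.L ≤ α * δ₀ * g.R * g.M)
    (hρ : 0 ≤ ρ) (hσ : 0 ≤ σ) (hρP : ρ + σ + α * δ₀ ≤ δP) (y y' : g.Site) :
    ∑ y'', (g.len y'' ^ 2)⁻¹ * Real.exp (-(δP * g.dist y'' y')) * (g.len y ^ 2 * Real.exp (-(δP * g.dist y y'')))
      ≤ g.L ^ 2 * c * Real.exp (-(ρ * g.dist y y')) := by
  have hterm : ∀ y'', (g.len y'' ^ 2)⁻¹ * Real.exp (-(δP * g.dist y'' y')) * (g.len y ^ 2 * Real.exp (-(δP * g.dist y y'')))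
      ≤ g.L ^ 2 * (Real.exp (-((δP - α * δ₀) * g.dist y y'')) * Real.exp (-(δP * g.dist y'' y'))) := by
    intro y''
    have hl : 0 < g.len y'' ^ 2 := pow_pos (len_pos hL hη y'') 2
    have ht := len_sq_le_transfer h260 hαδ hd hsym hL hη.le hRM y y''
    have hratio : (g.len y'' ^ 2)⁻¹ * g.len y ^ 2 ≤ g.L ^ 2 * Real.exp (α * δ₀ * g.dist y y'') := by
      rw [inv_mul_le_iff₀ hl]
      calc g.len y ^ 2 ≤ g.L ^ 2 * g.len y'' ^ 2 * Real.exp (α * δ₀ * g.dist y y'') := ht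
        _ = g.len y'' ^ 2 * (g.L ^ 2 * Real.exp (α * δ₀ * g.dist y y'')) := by ring
    calc (g.len y'' ^ 2)⁻¹ * Real.exp (-(δP * g.dist y'' y')) * (g.len y ^ 2 * Real.exp (-(δP * g.dist y y'')))
        = (g.len y'' ^ 2)⁻¹ * g.len y ^ 2 * (Real.exp (-(δP * g.dist y y'')) * Real.exp (-(δP * g.dist y'' y'))) := by
          ring
      _ ≤ g.L ^ 2 * Real.exp (α * δ₀ * g.dist y y'') *
            (Real.exp (-(δP * g.dist y y'')) * Real.exp (-(δP * g.dist y'' y'))) :=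
          mul_le_mul_of_nonneg_right hratio (mul_nonneg (Real.exp_nonneg _) (Real.exp_nonneg _))
      _ = g.L ^ 2 * (Real.exp (-((δP - α * δ₀) * g.dist y y'')) * Real.exp (-(δP * g.dist y'' y'))) := by
          rw [← exp_transfer_mul (α * δ₀) δP (g.dist y y'')]; ring
  have hconv := conv_exp_le (ρ₁ := δP - α * δ₀) (ρ₂ := δP) htri hd hrow hρ (by linarith) (by linarith) y y'
  calc ∑ y'', (g.len y'' ^ 2)⁻¹ * Real.exp (-(δP * g.dist y'' y')) * (g.len y ^ 2 * Real.exp (-(δP * g.dist y y'')))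
      ≤ ∑ y'', g.L ^ 2 * (Real.exp (-((δP - α * δ₀) * g.dist y y'')) * Real.exp (-(δP * g.dist y'' y'))) :=
        Finset.sum_le_sum fun y'' _ => hterm y''
    _ = g.L ^ 2 * ∑ y'', Real.exp (-((δP - α * δ₀) * g.dist y y'')) * Real.exp (-(δP * g.dist y'' y')) := by
        rw [Finset.mul_sum]
    _ ≤ g.L ^ 2 * (c * Real.exp (-(ρ * g.dist y y'))) :=
        mul_le_mul_of_nonneg_left hconv (pow_nonneg (by linarith) 2)
    _ = g.L ^ 2 * c * Real.exp (-(ρ * g.dist y y')) := by ring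

/-- **Convolution for the power-1 spread term** (T6 of §3):
`Σ_{y″} (L^{j″}η)^{−1}e^{−δ_Pd(y″,y′)}·[(L^jη)e^{−δ_Pd(y,y″)}] ≦ L·c·e^{−ρd(y,y′)}` under the same conditions.
[cite: Balaban1985BackgroundPropagators, (3.131) p.422 + p.398; Balaban1984PropagatorsII, (2.54) p.233, Lemma 2.1 (2.60)–(2.61) p.234] -/
theorem conv_lin_le {δ₀ α σ c δP ρ : ℝ} (h260 : Ineq260 g δ₀ α) (hαδ : 0 ≤ α * δ₀)
    (hd : ∀ a b : g.Site, 0 ≤ g.dist a b) (hsym : DistSymm g) (htri : Triangle254 g) (hrow : RowSum g σ c)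
    (hL : 1 ≤ g.L) (hη : 0 < g.eta) (hRM : 2 * Real.log g.L ≤ α * δ₀ * g.R * g.M)
    (hρ : 0 ≤ ρ) (hσ : 0 ≤ σ) (hρP : ρ + σ + α * δ₀ ≤ δP) (y y' : g.Site) :
    ∑ y'', (g.len y'')⁻¹ * Real.exp (-(δP * g.dist y'' y')) * (g.len y * Real.exp (-(δP * g.dist y y'')))
      ≤ g.L * c * Real.exp (-(ρ * g.dist y y')) := by
  have hterm : ∀ y'', (g.len y'')⁻¹ * Real.exp (-(δP * g.dist y'' y')) * (g.len y * Real.exp (-(δP * g.dist y y'')))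
      ≤ g.L * (Real.exp (-((δP - α * δ₀) * g.dist y y'')) * Real.exp (-(δP * g.dist y'' y'))) := by
    intro y''
    have hl : 0 < g.len y'' := len_pos hL hη y''
    have ht := len_le_transfer h260 hαδ hd hsym hL hη.le hRM y y''
    have hratio : (g.len y'')⁻¹ * g.len y ≤ g.L * Real.exp (α * δ₀ * g.dist y y'') := by
      rw [inv_mul_le_iff₀ hl]
      calc g.len y ≤ g.L * g.len y'' * Real.exp (α * δ₀ * g.dist y y'') := ht
        _ = g.len y'' * (g.L * Real.exp (α * δ₀ * g.dist y y'')) := by ring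
    calc (g.len y'')⁻¹ * Real.exp (-(δP * g.dist y'' y')) * (g.len y * Real.exp (-(δP * g.dist y y'')))
        = (g.len y'')⁻¹ * g.len y * (Real.exp (-(δP * g.dist y y'')) * Real.exp (-(δP * g.dist y'' y'))) := by ring
      _ ≤ g.L * Real.exp (α * δ₀ * g.dist y y'') *
            (Real.exp (-(δP * g.dist y y'')) * Real.exp (-(δP * g.dist y'' y'))) :=
          mul_le_mul_of_nonneg_right hratio (mul_nonneg (Real.exp_nonneg _) (Real.exp_nonneg _))
      _ = g.L * (Real.exp (-((δP - α * δ₀) * g.dist y y'')) * Real.exp (-(δP * g.dist y'' y'))) := by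
          rw [← exp_transfer_mul (α * δ₀) δP (g.dist y y'')]; ring
  have hconv := conv_exp_le (ρ₁ := δP - α * δ₀) (ρ₂ := δP) htri hd hrow hρ (by linarith) (by linarith) y y'
  calc ∑ y'', (g.len y'')⁻¹ * Real.exp (-(δP * g.dist y'' y')) * (g.len y * Real.exp (-(δP * g.dist y y'')))
      ≤ ∑ y'', g.L * (Real.exp (-((δP - α * δ₀) * g.dist y y'')) * Real.exp (-(δP * g.dist y'' y'))) :=
        Finset.sum_le_sum fun y'' _ => hterm y''
    _ = g.L * ∑ y'', Real.exp (-((δP - α * δ₀) * g.dist y y'')) * Real.exp (-(δP * g.dist y'' y')) := by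
        rw [Finset.mul_sum]
    _ ≤ g.L * (c * Real.exp (-(ρ * g.dist y y'))) := mul_le_mul_of_nonneg_left hconv (by linarith)
    _ = g.L * c * Real.exp (-(ρ * g.dist y y')) := by ring

end Rates

/-! ## §3 The assembly of (3.131) -/

section Assembly

variable {𝔸 : Type*} [NormedRing 𝔸] [NormedAlgebra ℂ 𝔸] [CompleteSpace 𝔸]
variable {S : Type*} [Fintype S] {ι : Type*} [Fintype ι] [LinearOrder ι]
variable (T : ι → Equiv.Perm S) (U : ι → S → 𝔸ˣ)
variable {g : B6.Geometry} (blk : S → g.Site)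

/-- **The O(1) of (3.131), explicit**: `O₁ = ‖τ‖·c_J·C_P·(2 + 2|ι|L² + C_P·c·(|ι|L² + L))` in terms of the norm of the trace functional,
the constant `c_J` of the J-bound ((3.36)), the constant `C_P` of the Theorem 3.1 ∘ (3.49) entries, the number of directions `|ι|` (= d),
the scale factor `L` (one transfer (2.60) per term, powers ≦ 2) and the row-sum constant `c` of (2.61).
[cite: Balaban1985BackgroundPropagators, (3.131) p.422] -/
def O1 (nτ cJ CP nι L c : ℝ) : ℝ := nτ * cJ * CP * (2 + 2 * nι * L ^ 2 + CP * c * (nι * L ^ 2 + L))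

/-- `O1` unfolded. [cite: Balaban1985BackgroundPropagators, (3.131) p.422] -/
theorem O1_def (nτ cJ CP nι L c : ℝ) : O1 nτ cJ CP nι L c = nτ * cJ * CP * (2 + 2 * nι * L ^ 2 + CP * c * (nι * L ^ 2 + L)) :=
  rfl

omit [CompleteSpace 𝔸] in
open Classical in
/-- **(3.131) ASSEMBLED** (p. 422; the bookkeeping the print calls *"easy to find … using Theorem 3.1 and the inequality (3.49)"*,
with *"one of the three derivatives … applied either to an expression on the right, or on the left, of Δ′_π"*).  Data: the exact-background
lattice `(S, ι, T, U)` with unit-bounded bond variables, a bounded trace functional `τ`, `η > 0`; a block map `blk : S → 𝔅` into a multiscale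
geometry `g` (x ∈ Δ(blk x)); the map `𝒫` (print: `G′RD*`, kept abstract) with `λᵢ = 𝒫Aᵢ`; bond functions `A₁` supported in Δ(y), `A₂` in
Δ(y′) with `|A₂| ≦ a₂`.  Inputs, each of the printed shape: `hJ` = (3.36) as used on p. 422 (`|J(b)| ≦ c_J·Mα₀·(L^{j(b)}η)^{−3}`);
`hS0/hS0s/hS1` = the sup entries (3.42)₁,₂ ∘ (3.49) for `λ₂` with size factor `n₂` (read `|D*A₂|`) over each cube and its unit
translates; `hL0/hL0s/hL1` = the L¹ (dual) entries (3.42)₁,₃ ∘ (3.49) for `λ₁` with size factor `m₁` (read `‖D*A₁‖_{L¹}`); the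
geometry of [4]: `d ≧ 0` symmetric, (2.54), the row sum (2.61) at rate `σ`, (2.60) at rate `αδ₀` with `2 log L ≦ αδ₀RM`, `L ≧ 1`.
Conclusion, for every rate `ρ ≧ 0` with `ρ + σ + αδ₀ ≦ δ_P`:
`|⟨A₁,Δ′_πA₂⟩| ≦ O₁·Mα₀·(m₁ + (L^jη)^{−1}‖A₁‖_{L¹})·e^{−ρd(y,y′)}·(n₂ + (L^{j′}η)^{−1}a₂)`.
[cite: Balaban1985BackgroundPropagators, (3.131) p.422, (3.42) p.397, (3.49) p.399, (3.36) p.396, p.398; Balaban1984PropagatorsII, Lemma 2.1 (2.60)–(2.61) p.234, (2.54) p.233] -/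
theorem ineq3131_assembled
    (hU : ∀ μ x, ‖(U μ x : 𝔸)‖ ≤ 1 ∧ ‖(((U μ x)⁻¹ : 𝔸ˣ) : 𝔸)‖ ≤ 1) (τ : 𝔸 →L[ℂ] ℂ) {η : ℝ} (hη : 0 < η) (d : ℕ)
    (P : (ι → S → 𝔸) → S → 𝔸) (A₁ A₂ : ι → S → 𝔸) (y y' : g.Site)
    (hd : ∀ a b : g.Site, 0 ≤ g.dist a b) (hsym : DistSymm g) (htri : Triangle254 g)
    {σ c δ₀ α : ℝ} (hrow : RowSum g σ c) (h260 : Ineq260 g δ₀ α) (hαδ : 0 ≤ α * δ₀) (hσ : 0 ≤ σ)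
    (hL : 1 ≤ g.L) (hge : 0 < g.eta) (hRM : 2 * Real.log g.L ≤ α * δ₀ * g.R * g.M)
    {δP ρ : ℝ} (hρ : 0 ≤ ρ) (hρP : ρ + σ + α * δ₀ ≤ δP)
    (hA₁ : ∀ μ x, blk x ≠ y → A₁ μ x = 0) (hA₂ : ∀ μ x, blk x ≠ y' → A₂ μ x = 0)
    {a₂ : ℝ} (ha₂0 : 0 ≤ a₂) (ha₂ : ∀ μ x, ‖A₂ μ x‖ ≤ a₂)
    {cJ Ma : ℝ} (hcJ : 0 ≤ cJ) (hMa : 0 ≤ Ma)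
    (hJ : ∀ μ x, ‖J T U η μ x‖ ≤ cJ * Ma * (g.len (blk x) ^ 3)⁻¹)
    {CP n₂ m₁ : ℝ} (hCP : 0 ≤ CP) (hn₂ : 0 ≤ n₂) (hm₁ : 0 ≤ m₁)
    (hS0 : ∀ x, ‖P A₂ x‖ ≤ CP * g.len (blk x) ^ 2 * Real.exp (-(δP * g.dist (blk x) y')) * n₂)
    (hS0s : ∀ μ x, ‖P A₂ (T μ x)‖ ≤ CP * g.len (blk x) ^ 2 * Real.exp (-(δP * g.dist (blk x) y')) * n₂)
    (hS1 : ∀ μ x, ‖covDη T U η (P A₂) μ x‖ ≤ CP * g.len (blk x) * Real.exp (-(δP * g.dist (blk x) y')) * n₂)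
    (hL0 : ∀ y'', sl1On blk η d y'' (P A₁) ≤ CP * g.len y ^ 2 * Real.exp (-(δP * g.dist y y'')) * m₁)
    (hL0s : ∀ y'' μ, sl1On blk η d y'' (P A₁ ∘ (T μ)) ≤ CP * g.len y ^ 2 * Real.exp (-(δP * g.dist y y'')) * m₁)
    (hL1 : ∀ y'', bl1On blk η d y'' (covDη T U η (P A₁)) ≤ CP * g.len y * Real.exp (-(δP * g.dist y y'')) * m₁) :
    ‖deltaPiPrimeBil T U η d (τ : 𝔸 →ₗ[ℂ] ℂ) P A₁ A₂‖ ≤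
      O1 ‖τ‖ cJ CP (Fintype.card ι) g.L c * Ma * (m₁ + (g.len y)⁻¹ * bl1 η d A₁)
        * Real.exp (-(ρ * g.dist y y')) * (n₂ + (g.len y')⁻¹ * a₂) := by
  -- positivity bookkeeping
  have hLnn : 0 ≤ g.L := le_trans zero_le_one hL
  have hlen : ∀ z : g.Site, 0 < g.len z := len_pos hL hge
  have hηd : 0 < η ^ d := pow_pos hη d
  have hc : 0 ≤ c := hrow.nonneg y
  have hnι : (0 : ℝ) ≤ Fintype.card ι := Nat.cast_nonneg _
  have hρδ : ρ ≤ δP := by linarith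
  have hKJ0 : ∀ z : g.Site, 0 ≤ cJ * Ma * (g.len z ^ 3)⁻¹ := fun z =>
    mul_nonneg (mul_nonneg hcJ hMa) (inv_nonneg.mpr (pow_nonneg (hlen z).le 3))
  have hinv32 : ∀ z : g.Site, (g.len z ^ 3)⁻¹ * g.len z ^ 2 = (g.len z)⁻¹ := fun z => by
    have hz : g.len z ≠ 0 := (hlen z).ne'
    field_simp
  have hinv31 : ∀ z : g.Site, (g.len z ^ 3)⁻¹ * g.len z = (g.len z ^ 2)⁻¹ := fun z => by
    have hz : g.len z ≠ 0 := (hlen z).ne'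
    field_simp
  -- abbreviations
  set E : ℝ := Real.exp (-(ρ * g.dist y y')) with hE
  set E₀ : ℝ := Real.exp (-(δP * g.dist y y')) with hE₀
  set B : ℝ := bl1 η d A₁ with hB
  set nι : ℝ := (Fintype.card ι : ℝ) with hnιdef
  have hE0 : 0 ≤ E := Real.exp_nonneg _
  have hE₀E : E₀ ≤ E := exp_rate_mono hρδ (hd y y')
  have hB0 : 0 ≤ B := bl1_nonneg hη.le d A₁
  -- the transfer y → y′ used by the two A₂-supported terms: (L^jη)² e^{−δ_P d} ≦ L² (L^{j′}η)² e^{−ρ d}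
  have htr : g.len y ^ 2 * E₀ ≤ g.L ^ 2 * g.len y' ^ 2 * E := by
    have ht := len_sq_le_transfer h260 hαδ hd hsym hL hge.le hRM y y'
    calc g.len y ^ 2 * E₀ ≤ g.L ^ 2 * g.len y' ^ 2 * Real.exp (α * δ₀ * g.dist y y') * E₀ :=
          mul_le_mul_of_nonneg_right ht (Real.exp_nonneg _)
      _ = g.L ^ 2 * g.len y' ^ 2 * Real.exp (-((δP - α * δ₀) * g.dist y y')) := by
          rw [hE₀, mul_assoc, exp_transfer_mul]
      _ ≤ g.L ^ 2 * g.len y' ^ 2 * E :=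
          mul_le_mul_of_nonneg_left (exp_rate_mono (by linarith) (hd y y'))
            (mul_nonneg (pow_nonneg hLnn 2) (pow_nonneg (hlen y').le 2))
  -- §0 the pointwise majorization (landed, `B9Eq3131Pointwise`)
  have h0 := norm_deltaPiPrimeBil_le T U hU τ hη d P A₁ A₂
  -- the six sums
  set S1 : ℝ := ∑ x, ∑ μ, ‖J T U η μ x‖ * (‖P A₂ x‖ * ‖A₁ μ x‖) with hS1def
  set S2 : ℝ := ∑ x, ∑ μ, ‖J T U η μ x‖ * (‖P A₁ x‖ * ‖A₂ μ x‖) with hS2def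
  set S3 : ℝ := ∑ x, ∑ μ, ‖J T U η μ x‖ * (‖A₁ μ x‖ * ‖P A₂ (T μ x)‖) with hS3def
  set S4 : ℝ := ∑ x, ∑ μ, ‖J T U η μ x‖ * (‖A₂ μ x‖ * ‖P A₁ (T μ x)‖) with hS4def
  set S5 : ℝ := ∑ x, ∑ μ, ‖J T U η μ x‖ * (‖P A₁ x‖ * ‖covDη T U η (P A₂) μ x‖) with hS5def
  set S6 : ℝ := ∑ x, ∑ μ, ‖J T U η μ x‖ * (‖P A₂ x‖ * ‖covDη T U η (P A₁) μ x‖) with hS6def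
  have hsplit : ∑ x, ∑ μ, ‖J T U η μ x‖ *
        (‖P A₂ x‖ * ‖A₁ μ x‖ + ‖P A₁ x‖ * ‖A₂ μ x‖ + ‖A₁ μ x‖ * ‖P A₂ (T μ x)‖ + ‖A₂ μ x‖ * ‖P A₁ (T μ x)‖
          + ‖P A₁ x‖ * ‖covDη T U η (P A₂) μ x‖ + ‖P A₂ x‖ * ‖covDη T U η (P A₁) μ x‖)
      = S1 + S2 + S3 + S4 + S5 + S6 := by
    simp only [hS1def, hS2def, hS3def, hS4def, hS5def, hS6def, mul_add, Finset.sum_add_distrib]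
  -- T1: A₁ un-differentiated, λ₂ at b₋
  have hT1 : S1 ≤ (cJ * Ma * (g.len y ^ 3)⁻¹) * (CP * g.len y ^ 2 * E₀ * n₂) * ∑ x, ∑ μ, ‖A₁ μ x‖ := by
    have h := term_supp_le blk (w := fun μ x => ‖J T U η μ x‖) (l := fun _ x => ‖P A₂ x‖) (a := fun μ x => ‖A₁ μ x‖)
      (y := y) (K := (cJ * Ma * (g.len y ^ 3)⁻¹) * (CP * g.len y ^ 2 * E₀ * n₂))
      (fun μ x => norm_nonneg _) (fun μ x hx => by rw [hA₁ μ x hx, norm_zero])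
      (fun μ x hx => by
        have h1 := hJ μ x
        have h2 := hS0 x
        rw [hx] at h1 h2
        exact mul_le_mul h1 h2 (norm_nonneg _) (hKJ0 y))
    calc S1 = ∑ x, ∑ μ, ‖J T U η μ x‖ * ‖P A₂ x‖ * ‖A₁ μ x‖ :=
          Finset.sum_congr rfl fun x _ => Finset.sum_congr rfl fun μ _ => by ring
      _ ≤ _ := h
  -- T3: A₁ un-differentiated, λ₂ at b₊
  have hT3 : S3 ≤ (cJ * Ma * (g.len y ^ 3)⁻¹) * (CP * g.len y ^ 2 * E₀ * n₂) * ∑ x, ∑ μ, ‖A₁ μ x‖ := by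
    have h := term_supp_le blk (w := fun μ x => ‖J T U η μ x‖) (l := fun μ x => ‖P A₂ (T μ x)‖)
      (a := fun μ x => ‖A₁ μ x‖) (y := y) (K := (cJ * Ma * (g.len y ^ 3)⁻¹) * (CP * g.len y ^ 2 * E₀ * n₂))
      (fun μ x => norm_nonneg _) (fun μ x hx => by rw [hA₁ μ x hx, norm_zero])
      (fun μ x hx => by
        have h1 := hJ μ x
        have h2 := hS0s μ x
        rw [hx] at h1 h2
        exact mul_le_mul h1 h2 (norm_nonneg _) (hKJ0 y))
    calc S3 = ∑ x, ∑ μ, ‖J T U η μ x‖ * ‖P A₂ (T μ x)‖ * ‖A₁ μ x‖ :=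
          Finset.sum_congr rfl fun x _ => Finset.sum_congr rfl fun μ _ => by ring
      _ ≤ _ := h
  -- T2: A₂ un-differentiated, λ₁ at b₋
  have hT2 : S2 ≤ (cJ * Ma * (g.len y' ^ 3)⁻¹ * a₂) * ∑ x, ∑ _μ : ι, (if blk x = y' then ‖P A₁ x‖ else 0) := by
    have h := term_supp_le' blk (w := fun μ x => ‖J T U η μ x‖) (l := fun _ x => ‖P A₁ x‖) (a := fun μ x => ‖A₂ μ x‖)
      (y := y') (K := cJ * Ma * (g.len y' ^ 3)⁻¹ * a₂)
      (fun μ x => norm_nonneg _) (fun μ x hx => by rw [hA₂ μ x hx, norm_zero])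
      (fun μ x hx => by
        have h1 := hJ μ x
        rw [hx] at h1
        exact mul_le_mul h1 (ha₂ μ x) (norm_nonneg _) (hKJ0 y'))
    calc S2 = ∑ x, ∑ μ, ‖J T U η μ x‖ * ‖P A₁ x‖ * ‖A₂ μ x‖ :=
          Finset.sum_congr rfl fun x _ => Finset.sum_congr rfl fun μ _ => by ring
      _ ≤ _ := h
  -- T4: A₂ un-differentiated, λ₁ at b₊
  have hT4 : S4 ≤ (cJ * Ma * (g.len y' ^ 3)⁻¹ * a₂) * ∑ x, ∑ μ, (if blk x = y' then ‖P A₁ (T μ x)‖ else 0) := by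
    have h := term_supp_le' blk (w := fun μ x => ‖J T U η μ x‖) (l := fun μ x => ‖P A₁ (T μ x)‖)
      (a := fun μ x => ‖A₂ μ x‖) (y := y') (K := cJ * Ma * (g.len y' ^ 3)⁻¹ * a₂)
      (fun μ x => norm_nonneg _) (fun μ x hx => by rw [hA₂ μ x hx, norm_zero])
      (fun μ x hx => by
        have h1 := hJ μ x
        rw [hx] at h1
        exact mul_le_mul h1 (ha₂ μ x) (norm_nonneg _) (hKJ0 y'))
    calc S4 = ∑ x, ∑ μ, ‖J T U η μ x‖ * ‖P A₁ (T μ x)‖ * ‖A₂ μ x‖ :=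
          Finset.sum_congr rfl fun x _ => Finset.sum_congr rfl fun μ _ => by ring
      _ ≤ _ := h
  -- T5: third term, derivative on λ₂ (right)
  have hT5 : S5 ≤ nι * ∑ y'', (cJ * Ma * (g.len y'' ^ 3)⁻¹ *
        (CP * g.len y'' * Real.exp (-(δP * g.dist y'' y')) * n₂)) * ∑ x, (if blk x = y'' then ‖P A₁ x‖ else 0) := by
    have h := term_fiber_le blk (w := fun μ x => ‖J T U η μ x‖) (l := fun x => ‖P A₁ x‖)
      (m := fun μ x => ‖covDη T U η (P A₂) μ x‖)
      (F := fun y'' => cJ * Ma * (g.len y'' ^ 3)⁻¹ * (CP * g.len y'' * Real.exp (-(δP * g.dist y'' y')) * n₂))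
      (fun x => norm_nonneg _) (fun μ x => mul_le_mul (hJ μ x) (hS1 μ x) (norm_nonneg _) (hKJ0 (blk x)))
    calc S5 = ∑ x, ∑ μ, ‖J T U η μ x‖ * ‖P A₁ x‖ * ‖covDη T U η (P A₂) μ x‖ :=
          Finset.sum_congr rfl fun x _ => Finset.sum_congr rfl fun μ _ => by ring
      _ ≤ _ := h
  -- T6: third term, derivative on λ₁ (left)
  have hT6 : S6 ≤ ∑ y'', (cJ * Ma * (g.len y'' ^ 3)⁻¹ *
        (CP * g.len y'' ^ 2 * Real.exp (-(δP * g.dist y'' y')) * n₂)) *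
          ∑ x, (if blk x = y'' then ∑ μ, ‖covDη T U η (P A₁) μ x‖ else 0) := by
    have h := term_fiber_le' blk (w := fun μ x => ‖J T U η μ x‖) (l := fun x => ‖P A₂ x‖)
      (m := fun μ x => ‖covDη T U η (P A₁) μ x‖)
      (F := fun y'' => cJ * Ma * (g.len y'' ^ 3)⁻¹ * (CP * g.len y'' ^ 2 * Real.exp (-(δP * g.dist y'' y')) * n₂))
      (fun μ x => norm_nonneg _) (fun μ x => mul_le_mul (hJ μ x) (hS0 x) (norm_nonneg _) (hKJ0 (blk x)))
    calc S6 = ∑ x, ∑ μ, ‖J T U η μ x‖ * ‖P A₂ x‖ * ‖covDη T U η (P A₁) μ x‖ :=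
          Finset.sum_congr rfl fun x _ => Finset.sum_congr rfl fun μ _ => by ring
      _ ≤ _ := h
  -- η^d × the six sums, with the L¹ hypotheses inserted and the rates transferred
  have hR1 : η ^ d * S1 ≤ cJ * Ma * CP * n₂ * ((g.len y)⁻¹ * B) * E := by
    have hK : 0 ≤ (cJ * Ma * (g.len y ^ 3)⁻¹) * (CP * g.len y ^ 2 * E₀ * n₂) :=
      mul_nonneg (hKJ0 y) (mul_nonneg (mul_nonneg (mul_nonneg hCP (pow_nonneg (hlen y).le 2)) (Real.exp_nonneg _)) hn₂)
    calc η ^ d * S1 ≤ η ^ d * ((cJ * Ma * (g.len y ^ 3)⁻¹) * (CP * g.len y ^ 2 * E₀ * n₂) * ∑ x, ∑ μ, ‖A₁ μ x‖) :=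
          mul_le_mul_of_nonneg_left hT1 hηd.le
      _ = cJ * Ma * CP * n₂ * (((g.len y ^ 3)⁻¹ * g.len y ^ 2) * B) * E₀ := by rw [hB, bl1]; ring
      _ = cJ * Ma * CP * n₂ * ((g.len y)⁻¹ * B) * E₀ := by rw [hinv32 y]
      _ ≤ cJ * Ma * CP * n₂ * ((g.len y)⁻¹ * B) * E :=
          mul_le_mul_of_nonneg_left hE₀E (mul_nonneg (mul_nonneg (mul_nonneg (mul_nonneg hcJ hMa) hCP) hn₂)
            (mul_nonneg (inv_nonneg.mpr (hlen y).le) hB0))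
  have hR3 : η ^ d * S3 ≤ cJ * Ma * CP * n₂ * ((g.len y)⁻¹ * B) * E := by
    calc η ^ d * S3 ≤ η ^ d * ((cJ * Ma * (g.len y ^ 3)⁻¹) * (CP * g.len y ^ 2 * E₀ * n₂) * ∑ x, ∑ μ, ‖A₁ μ x‖) :=
          mul_le_mul_of_nonneg_left hT3 hηd.le
      _ = cJ * Ma * CP * n₂ * (((g.len y ^ 3)⁻¹ * g.len y ^ 2) * B) * E₀ := by rw [hB, bl1]; ring
      _ = cJ * Ma * CP * n₂ * ((g.len y)⁻¹ * B) * E₀ := by rw [hinv32 y]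
      _ ≤ cJ * Ma * CP * n₂ * ((g.len y)⁻¹ * B) * E :=
          mul_le_mul_of_nonneg_left hE₀E (mul_nonneg (mul_nonneg (mul_nonneg (mul_nonneg hcJ hMa) hCP) hn₂)
            (mul_nonneg (inv_nonneg.mpr (hlen y).le) hB0))
  have hR2 : η ^ d * S2 ≤ cJ * Ma * CP * nι * g.L ^ 2 * m₁ * ((g.len y')⁻¹ * a₂) * E := by
    have hK : 0 ≤ cJ * Ma * (g.len y' ^ 3)⁻¹ * a₂ := mul_nonneg (hKJ0 y') ha₂0
    have hsum : ∑ x, ∑ _μ : ι, (if blk x = y' then ‖P A₁ x‖ else 0) = nι * ∑ x, (if blk x = y' then ‖P A₁ x‖ else 0) := by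
      rw [Finset.mul_sum]
      refine Finset.sum_congr rfl fun x _ => ?_
      rw [Finset.sum_const, Finset.card_univ, nsmul_eq_mul]
    have hsl : η ^ d * ∑ x, (if blk x = y' then ‖P A₁ x‖ else 0) = sl1On blk η d y' (P A₁) := rfl
    calc η ^ d * S2 ≤ η ^ d * ((cJ * Ma * (g.len y' ^ 3)⁻¹ * a₂) * ∑ x, ∑ _μ : ι, (if blk x = y' then ‖P A₁ x‖ else 0)) :=
          mul_le_mul_of_nonneg_left hT2 hηd.le
      _ = (cJ * Ma * (g.len y' ^ 3)⁻¹ * a₂) * nι * sl1On blk η d y' (P A₁) := by rw [hsum, ← hsl]; ring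
      _ ≤ (cJ * Ma * (g.len y' ^ 3)⁻¹ * a₂) * nι * (CP * g.len y ^ 2 * E₀ * m₁) :=
          mul_le_mul_of_nonneg_left (hL0 y') (mul_nonneg hK hnι)
      _ = (cJ * Ma * (g.len y' ^ 3)⁻¹ * a₂) * nι * CP * m₁ * (g.len y ^ 2 * E₀) := by ring
      _ ≤ (cJ * Ma * (g.len y' ^ 3)⁻¹ * a₂) * nι * CP * m₁ * (g.L ^ 2 * g.len y' ^ 2 * E) :=
          mul_le_mul_of_nonneg_left htr (mul_nonneg (mul_nonneg (mul_nonneg hK hnι) hCP) hm₁)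
      _ = cJ * Ma * CP * nι * g.L ^ 2 * m₁ * (((g.len y' ^ 3)⁻¹ * g.len y' ^ 2) * a₂) * E := by ring
      _ = cJ * Ma * CP * nι * g.L ^ 2 * m₁ * ((g.len y')⁻¹ * a₂) * E := by rw [hinv32 y']
  have hR4 : η ^ d * S4 ≤ cJ * Ma * CP * nι * g.L ^ 2 * m₁ * ((g.len y')⁻¹ * a₂) * E := by
    have hK : 0 ≤ cJ * Ma * (g.len y' ^ 3)⁻¹ * a₂ := mul_nonneg (hKJ0 y') ha₂0
    have hsl : ∀ μ, η ^ d * ∑ x, (if blk x = y' then ‖P A₁ (T μ x)‖ else 0) = sl1On blk η d y' (P A₁ ∘ (T μ)) :=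
      fun μ => rfl
    have hsum : η ^ d * ∑ x, ∑ μ, (if blk x = y' then ‖P A₁ (T μ x)‖ else 0)
        = ∑ μ, sl1On blk η d y' (P A₁ ∘ (T μ)) := by
      rw [Finset.sum_comm, Finset.mul_sum]
      exact Finset.sum_congr rfl fun μ _ => hsl μ
    have hbd : ∑ μ, sl1On blk η d y' (P A₁ ∘ (T μ)) ≤ nι * (CP * g.len y ^ 2 * E₀ * m₁) :=
      calc ∑ μ, sl1On blk η d y' (P A₁ ∘ (T μ)) ≤ ∑ _μ : ι, CP * g.len y ^ 2 * E₀ * m₁ :=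
            Finset.sum_le_sum fun μ _ => hL0s y' μ
        _ = nι * (CP * g.len y ^ 2 * E₀ * m₁) := by rw [Finset.sum_const, Finset.card_univ, nsmul_eq_mul]
    calc η ^ d * S4 ≤ η ^ d * ((cJ * Ma * (g.len y' ^ 3)⁻¹ * a₂) * ∑ x, ∑ μ, (if blk x = y' then ‖P A₁ (T μ x)‖ else 0)) :=
          mul_le_mul_of_nonneg_left hT4 hηd.le
      _ = (cJ * Ma * (g.len y' ^ 3)⁻¹ * a₂) * (η ^ d * ∑ x, ∑ μ, (if blk x = y' then ‖P A₁ (T μ x)‖ else 0)) := by ring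
      _ = (cJ * Ma * (g.len y' ^ 3)⁻¹ * a₂) * ∑ μ, sl1On blk η d y' (P A₁ ∘ (T μ)) := by rw [hsum]
      _ ≤ (cJ * Ma * (g.len y' ^ 3)⁻¹ * a₂) * (nι * (CP * g.len y ^ 2 * E₀ * m₁)) := mul_le_mul_of_nonneg_left hbd hK
      _ = (cJ * Ma * (g.len y' ^ 3)⁻¹ * a₂) * nι * CP * m₁ * (g.len y ^ 2 * E₀) := by ring
      _ ≤ (cJ * Ma * (g.len y' ^ 3)⁻¹ * a₂) * nι * CP * m₁ * (g.L ^ 2 * g.len y' ^ 2 * E) :=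
          mul_le_mul_of_nonneg_left htr (mul_nonneg (mul_nonneg (mul_nonneg hK hnι) hCP) hm₁)
      _ = cJ * Ma * CP * nι * g.L ^ 2 * m₁ * (((g.len y' ^ 3)⁻¹ * g.len y' ^ 2) * a₂) * E := by ring
      _ = cJ * Ma * CP * nι * g.L ^ 2 * m₁ * ((g.len y')⁻¹ * a₂) * E := by rw [hinv32 y']
  have hR5 : η ^ d * S5 ≤ cJ * Ma * CP * (CP * c * nι * g.L ^ 2) * m₁ * n₂ * E := by
    have hF0 : ∀ y'', 0 ≤ cJ * Ma * (g.len y'' ^ 3)⁻¹ * (CP * g.len y'' * Real.exp (-(δP * g.dist y'' y')) * n₂) :=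
      fun y'' => mul_nonneg (hKJ0 y'') (mul_nonneg (mul_nonneg (mul_nonneg hCP (hlen y'').le) (Real.exp_nonneg _)) hn₂)
    have hsl : ∀ y'', η ^ d * ∑ x, (if blk x = y'' then ‖P A₁ x‖ else 0) = sl1On blk η d y'' (P A₁) := fun y'' => rfl
    have hstep : η ^ d * ∑ y'', (cJ * Ma * (g.len y'' ^ 3)⁻¹ *
        (CP * g.len y'' * Real.exp (-(δP * g.dist y'' y')) * n₂)) * ∑ x, (if blk x = y'' then ‖P A₁ x‖ else 0)
        ≤ ∑ y'', (cJ * Ma * (g.len y'' ^ 3)⁻¹ * (CP * g.len y'' * Real.exp (-(δP * g.dist y'' y')) * n₂))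
            * (CP * g.len y ^ 2 * Real.exp (-(δP * g.dist y y'')) * m₁) := by
      rw [Finset.mul_sum]
      refine Finset.sum_le_sum fun y'' _ => ?_
      rw [mul_left_comm, hsl y'']
      exact mul_le_mul_of_nonneg_left (hL0 y'') (hF0 y'')
    have hconv := conv_sq_le h260 hαδ hd hsym htri hrow hL hge hRM hρ hσ hρP y y'
    have hident : ∑ y'', (cJ * Ma * (g.len y'' ^ 3)⁻¹ * (CP * g.len y'' * Real.exp (-(δP * g.dist y'' y')) * n₂))
            * (CP * g.len y ^ 2 * Real.exp (-(δP * g.dist y y'')) * m₁)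
        = cJ * Ma * CP * n₂ * CP * m₁ * ∑ y'', (g.len y'' ^ 2)⁻¹ * Real.exp (-(δP * g.dist y'' y'))
            * (g.len y ^ 2 * Real.exp (-(δP * g.dist y y''))) := by
      rw [Finset.mul_sum]
      refine Finset.sum_congr rfl fun y'' _ => ?_
      rw [← hinv31 y'']
      ring
    calc η ^ d * S5 ≤ η ^ d * (nι * ∑ y'', (cJ * Ma * (g.len y'' ^ 3)⁻¹ *
          (CP * g.len y'' * Real.exp (-(δP * g.dist y'' y')) * n₂)) * ∑ x, (if blk x = y'' then ‖P A₁ x‖ else 0)) :=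
          mul_le_mul_of_nonneg_left hT5 hηd.le
      _ = nι * (η ^ d * ∑ y'', (cJ * Ma * (g.len y'' ^ 3)⁻¹ *
          (CP * g.len y'' * Real.exp (-(δP * g.dist y'' y')) * n₂)) * ∑ x, (if blk x = y'' then ‖P A₁ x‖ else 0)) := by
          ring
      _ ≤ nι * ∑ y'', (cJ * Ma * (g.len y'' ^ 3)⁻¹ * (CP * g.len y'' * Real.exp (-(δP * g.dist y'' y')) * n₂))
            * (CP * g.len y ^ 2 * Real.exp (-(δP * g.dist y y'')) * m₁) := mul_le_mul_of_nonneg_left hstep hnι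
      _ = nι * (cJ * Ma * CP * n₂ * CP * m₁ * ∑ y'', (g.len y'' ^ 2)⁻¹ * Real.exp (-(δP * g.dist y'' y'))
            * (g.len y ^ 2 * Real.exp (-(δP * g.dist y y'')))) := by rw [hident]
      _ ≤ nι * (cJ * Ma * CP * n₂ * CP * m₁ * (g.L ^ 2 * c * E)) :=
          mul_le_mul_of_nonneg_left (mul_le_mul_of_nonneg_left hconv
            (mul_nonneg (mul_nonneg (mul_nonneg (mul_nonneg (mul_nonneg hcJ hMa) hCP) hn₂) hCP) hm₁)) hnι
      _ = cJ * Ma * CP * (CP * c * nι * g.L ^ 2) * m₁ * n₂ * E := by ring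
  have hR6 : η ^ d * S6 ≤ cJ * Ma * CP * (CP * c * g.L) * m₁ * n₂ * E := by
    have hF0 : ∀ y'', 0 ≤ cJ * Ma * (g.len y'' ^ 3)⁻¹ * (CP * g.len y'' ^ 2 * Real.exp (-(δP * g.dist y'' y')) * n₂) :=
      fun y'' => mul_nonneg (hKJ0 y'') (mul_nonneg (mul_nonneg (mul_nonneg hCP (pow_nonneg (hlen y'').le 2))
        (Real.exp_nonneg _)) hn₂)
    have hbl : ∀ y'', η ^ d * ∑ x, (if blk x = y'' then ∑ μ, ‖covDη T U η (P A₁) μ x‖ else 0)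
        = bl1On blk η d y'' (covDη T U η (P A₁)) := fun y'' => rfl
    have hstep : η ^ d * ∑ y'', (cJ * Ma * (g.len y'' ^ 3)⁻¹ *
        (CP * g.len y'' ^ 2 * Real.exp (-(δP * g.dist y'' y')) * n₂)) *
          ∑ x, (if blk x = y'' then ∑ μ, ‖covDη T U η (P A₁) μ x‖ else 0)
        ≤ ∑ y'', (cJ * Ma * (g.len y'' ^ 3)⁻¹ * (CP * g.len y'' ^ 2 * Real.exp (-(δP * g.dist y'' y')) * n₂))
            * (CP * g.len y * Real.exp (-(δP * g.dist y y'')) * m₁) := by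
      rw [Finset.mul_sum]
      refine Finset.sum_le_sum fun y'' _ => ?_
      rw [mul_left_comm, hbl y'']
      exact mul_le_mul_of_nonneg_left (hL1 y'') (hF0 y'')
    have hconv := conv_lin_le h260 hαδ hd hsym htri hrow hL hge hRM hρ hσ hρP y y'
    have hident : ∑ y'', (cJ * Ma * (g.len y'' ^ 3)⁻¹ * (CP * g.len y'' ^ 2 * Real.exp (-(δP * g.dist y'' y')) * n₂))
            * (CP * g.len y * Real.exp (-(δP * g.dist y y'')) * m₁)
        = cJ * Ma * CP * n₂ * CP * m₁ * ∑ y'', (g.len y'')⁻¹ * Real.exp (-(δP * g.dist y'' y'))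
            * (g.len y * Real.exp (-(δP * g.dist y y''))) := by
      rw [Finset.mul_sum]
      refine Finset.sum_congr rfl fun y'' _ => ?_
      rw [← hinv32 y'']
      ring
    calc η ^ d * S6 ≤ η ^ d * ∑ y'', (cJ * Ma * (g.len y'' ^ 3)⁻¹ *
          (CP * g.len y'' ^ 2 * Real.exp (-(δP * g.dist y'' y')) * n₂)) *
            ∑ x, (if blk x = y'' then ∑ μ, ‖covDη T U η (P A₁) μ x‖ else 0) :=
          mul_le_mul_of_nonneg_left hT6 hηd.le
      _ ≤ ∑ y'', (cJ * Ma * (g.len y'' ^ 3)⁻¹ * (CP * g.len y'' ^ 2 * Real.exp (-(δP * g.dist y'' y')) * n₂))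
            * (CP * g.len y * Real.exp (-(δP * g.dist y y'')) * m₁) := hstep
      _ = cJ * Ma * CP * n₂ * CP * m₁ * ∑ y'', (g.len y'')⁻¹ * Real.exp (-(δP * g.dist y'' y'))
            * (g.len y * Real.exp (-(δP * g.dist y y''))) := hident
      _ ≤ cJ * Ma * CP * n₂ * CP * m₁ * (g.L * c * E) :=
          mul_le_mul_of_nonneg_left hconv
            (mul_nonneg (mul_nonneg (mul_nonneg (mul_nonneg (mul_nonneg hcJ hMa) hCP) hn₂) hCP) hm₁)
      _ = cJ * Ma * CP * (CP * c * g.L) * m₁ * n₂ * E := by ring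
  -- the final arithmetic: three cross products under the printed product form
  set u : ℝ := (g.len y)⁻¹ * B with hu
  set v : ℝ := (g.len y')⁻¹ * a₂ with hv
  have hu0 : 0 ≤ u := mul_nonneg (inv_nonneg.mpr (hlen y).le) hB0
  have hv0 : 0 ≤ v := mul_nonneg (inv_nonneg.mpr (hlen y').le) ha₂0
  have k1 : n₂ * u ≤ (m₁ + u) * (n₂ + v) := by
    have e : (m₁ + u) * (n₂ + v) = n₂ * u + (m₁ * n₂ + m₁ * v + u * v) := by ring
    rw [e]
    exact le_add_of_nonneg_right (add_nonneg (add_nonneg (mul_nonneg hm₁ hn₂) (mul_nonneg hm₁ hv0)) (mul_nonneg hu0 hv0))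
  have k2 : m₁ * v ≤ (m₁ + u) * (n₂ + v) := by
    have e : (m₁ + u) * (n₂ + v) = m₁ * v + (m₁ * n₂ + u * n₂ + u * v) := by ring
    rw [e]
    exact le_add_of_nonneg_right (add_nonneg (add_nonneg (mul_nonneg hm₁ hn₂) (mul_nonneg hu0 hn₂)) (mul_nonneg hu0 hv0))
  have k3 : m₁ * n₂ ≤ (m₁ + u) * (n₂ + v) := by
    have e : (m₁ + u) * (n₂ + v) = m₁ * n₂ + (m₁ * v + u * n₂ + u * v) := by ring
    rw [e]
    exact le_add_of_nonneg_right (add_nonneg (add_nonneg (mul_nonneg hm₁ hv0) (mul_nonneg hu0 hn₂)) (mul_nonneg hu0 hv0))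
  have c2 : 0 ≤ 2 * nι * g.L ^ 2 := by positivity
  have c3 : 0 ≤ CP * c * (nι * g.L ^ 2 + g.L) := by positivity
  have hfin : 2 * n₂ * u + 2 * nι * g.L ^ 2 * m₁ * v + CP * c * (nι * g.L ^ 2 + g.L) * m₁ * n₂
      ≤ (2 + 2 * nι * g.L ^ 2 + CP * c * (nι * g.L ^ 2 + g.L)) * ((m₁ + u) * (n₂ + v)) := by
    have e : (2 + 2 * nι * g.L ^ 2 + CP * c * (nι * g.L ^ 2 + g.L)) * ((m₁ + u) * (n₂ + v))
        = 2 * ((m₁ + u) * (n₂ + v)) + 2 * nι * g.L ^ 2 * ((m₁ + u) * (n₂ + v))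
          + CP * c * (nι * g.L ^ 2 + g.L) * ((m₁ + u) * (n₂ + v)) := by ring
    rw [e]
    have i1 := mul_le_mul_of_nonneg_left k1 (zero_le_two (α := ℝ))
    have i2 := mul_le_mul_of_nonneg_left k2 c2
    have i3 := mul_le_mul_of_nonneg_left k3 c3
    linarith only [i1, i2, i3]
  have hsum : η ^ d * (S1 + S2 + S3 + S4 + S5 + S6)
      ≤ cJ * Ma * CP * E * (2 * n₂ * u + 2 * nι * g.L ^ 2 * m₁ * v + CP * c * (nι * g.L ^ 2 + g.L) * m₁ * n₂) := by
    have e1 : η ^ d * (S1 + S2 + S3 + S4 + S5 + S6)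
        = η ^ d * S1 + η ^ d * S2 + η ^ d * S3 + η ^ d * S4 + η ^ d * S5 + η ^ d * S6 := by ring
    have e2 : cJ * Ma * CP * E * (2 * n₂ * u + 2 * nι * g.L ^ 2 * m₁ * v + CP * c * (nι * g.L ^ 2 + g.L) * m₁ * n₂)
        = cJ * Ma * CP * n₂ * u * E + cJ * Ma * CP * nι * g.L ^ 2 * m₁ * v * E
          + cJ * Ma * CP * n₂ * u * E + cJ * Ma * CP * nι * g.L ^ 2 * m₁ * v * E
          + cJ * Ma * CP * (CP * c * nι * g.L ^ 2) * m₁ * n₂ * E + cJ * Ma * CP * (CP * c * g.L) * m₁ * n₂ * E := by ring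
    rw [e1, e2]
    linarith only [hR1, hR2, hR3, hR4, hR5, hR6]
  have hcoef : 0 ≤ ‖τ‖ * (cJ * Ma * CP * E) := by positivity
  calc ‖deltaPiPrimeBil T U η d (τ : 𝔸 →ₗ[ℂ] ℂ) P A₁ A₂‖
      ≤ ‖τ‖ * η ^ d * ∑ x, ∑ μ, ‖J T U η μ x‖ *
          (‖P A₂ x‖ * ‖A₁ μ x‖ + ‖P A₁ x‖ * ‖A₂ μ x‖ + ‖A₁ μ x‖ * ‖P A₂ (T μ x)‖ + ‖A₂ μ x‖ * ‖P A₁ (T μ x)‖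
            + ‖P A₁ x‖ * ‖covDη T U η (P A₂) μ x‖ + ‖P A₂ x‖ * ‖covDη T U η (P A₁) μ x‖) := h0
    _ = ‖τ‖ * (η ^ d * (S1 + S2 + S3 + S4 + S5 + S6)) := by rw [hsplit]; ring
    _ ≤ ‖τ‖ * (cJ * Ma * CP * E *
          (2 * n₂ * u + 2 * nι * g.L ^ 2 * m₁ * v + CP * c * (nι * g.L ^ 2 + g.L) * m₁ * n₂)) :=
        mul_le_mul_of_nonneg_left hsum (norm_nonneg _)
    _ = ‖τ‖ * (cJ * Ma * CP * E) *
          (2 * n₂ * u + 2 * nι * g.L ^ 2 * m₁ * v + CP * c * (nι * g.L ^ 2 + g.L) * m₁ * n₂) := by ring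
    _ ≤ ‖τ‖ * (cJ * Ma * CP * E) * ((2 + 2 * nι * g.L ^ 2 + CP * c * (nι * g.L ^ 2 + g.L)) * ((m₁ + u) * (n₂ + v))) :=
        mul_le_mul_of_nonneg_left hfin hcoef
    _ = O1 ‖τ‖ cJ CP (Fintype.card ι) g.L c * Ma * (m₁ + u) * E * (n₂ + v) := by rw [O1]; ring

/-! ## §4 (3.131) letter for letter: δ_P = δ₀, ρ = ½δ₀, the printed norms -/

omit [CompleteSpace 𝔸] in
/-- **(3.131) AS PRINTED** (p. 422): *"|⟨A₁Δ′_πA₂⟩| ≦ O(1)Mα₀(‖D*A₁‖_{L¹} + (L^jη)^{−1}‖A₁‖_{L¹})e^{−(1/2)δ₀d(y,y′)}(|D*A₂| +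
(L^{j′}η)^{−1}|A₂|) for supp A₁ ⊂ Δ(y), y ∈ Λ_j, supp A₂ ⊂ Δ(y′), y′ ∈ Λ_{j′}"* — the instance of `ineq3131_assembled` with the
Theorem 3.1 rate `δ_P = δ₀` in the inputs (the printed reading: with (3.49) taken literally the six inputs hold at `½δ₀` and `ineq3131_assembled`
then gives the conclusion at `½δ₀ − αδ₀ − σ`; the print's `½δ₀` is its generic-constant convention for δ₀, re-defined pp. 423–424 — cell GAPS
G-B9-r06-2), the conclusion rate `½δ₀`, and the printed norms: `‖D*A₁‖_{L¹} = sl1 η d (divBη T U η A₁)`,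
`‖A₁‖_{L¹} = bl1 η d A₁`, `|D*A₂| = ssup (divBη T U η A₂)`, `|A₂| = bsup A₂`, `L^jη = g.len y`, `L^{j′}η = g.len y′`; `O(1) = O1 …`
explicit; the rate budget of [4] Lemma 2.1 is the hypothesis `σ + αδ₀ ≦ ½δ₀` (row sum (2.61) at rate σ, transfer (2.60) at rate αδ₀).
The inputs `hS*`/`hL*` are the composites (3.42)₁,₂,₃ ∘ (3.49) for `𝒫 = G′RD*` in the printed shapes, read on the cubes Δ(y″) and their unit
translates (inside Δ̃(y″)); `hJ` is (3.36) in the form used on p. 422.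
[cite: Balaban1985BackgroundPropagators, (3.131) p.422, (3.42) p.397, (3.49) p.399, (3.36) p.396, p.398; Balaban1984PropagatorsII, Lemma 2.1 (2.60)–(2.61) p.234] -/
theorem ineq3131_printed
    (hU : ∀ μ x, ‖(U μ x : 𝔸)‖ ≤ 1 ∧ ‖(((U μ x)⁻¹ : 𝔸ˣ) : 𝔸)‖ ≤ 1) (τ : 𝔸 →L[ℂ] ℂ) {η : ℝ} (hη : 0 < η) (d : ℕ)
    (P : (ι → S → 𝔸) → S → 𝔸) (A₁ A₂ : ι → S → 𝔸) (y y' : g.Site)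
    (hd : ∀ a b : g.Site, 0 ≤ g.dist a b) (hsym : DistSymm g) (htri : Triangle254 g)
    {σ c δ₀ α : ℝ} (hrow : RowSum g σ c) (h260 : Ineq260 g δ₀ α) (hαδ : 0 ≤ α * δ₀) (hσ : 0 ≤ σ)
    (hhalf : σ + α * δ₀ ≤ δ₀ / 2)
    (hL : 1 ≤ g.L) (hge : 0 < g.eta) (hRM : 2 * Real.log g.L ≤ α * δ₀ * g.R * g.M)
    (hA₁ : ∀ μ x, blk x ≠ y → A₁ μ x = 0) (hA₂ : ∀ μ x, blk x ≠ y' → A₂ μ x = 0)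
    {cJ Ma : ℝ} (hcJ : 0 ≤ cJ) (hMa : 0 ≤ Ma)
    (hJ : ∀ μ x, ‖J T U η μ x‖ ≤ cJ * Ma * (g.len (blk x) ^ 3)⁻¹)
    {CP : ℝ} (hCP : 0 ≤ CP)
    (hS0 : ∀ x, ‖P A₂ x‖ ≤ CP * g.len (blk x) ^ 2 * Real.exp (-(δ₀ * g.dist (blk x) y')) * ssup (divBη T U η A₂))
    (hS0s : ∀ μ x, ‖P A₂ (T μ x)‖ ≤ CP * g.len (blk x) ^ 2 * Real.exp (-(δ₀ * g.dist (blk x) y')) * ssup (divBη T U η A₂))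
    (hS1 : ∀ μ x, ‖covDη T U η (P A₂) μ x‖
      ≤ CP * g.len (blk x) * Real.exp (-(δ₀ * g.dist (blk x) y')) * ssup (divBη T U η A₂))
    (hL0 : ∀ y'', sl1On blk η d y'' (P A₁) ≤ CP * g.len y ^ 2 * Real.exp (-(δ₀ * g.dist y y'')) * sl1 η d (divBη T U η A₁))
    (hL0s : ∀ y'' μ, sl1On blk η d y'' (P A₁ ∘ (T μ))
      ≤ CP * g.len y ^ 2 * Real.exp (-(δ₀ * g.dist y y'')) * sl1 η d (divBη T U η A₁))
    (hL1 : ∀ y'', bl1On blk η d y'' (covDη T U η (P A₁))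
      ≤ CP * g.len y * Real.exp (-(δ₀ * g.dist y y'')) * sl1 η d (divBη T U η A₁)) :
    ‖deltaPiPrimeBil T U η d (τ : 𝔸 →ₗ[ℂ] ℂ) P A₁ A₂‖ ≤
      O1 ‖τ‖ cJ CP (Fintype.card ι) g.L c * Ma * (sl1 η d (divBη T U η A₁) + (g.len y)⁻¹ * bl1 η d A₁)
        * Real.exp (-((1 / 2 : ℝ) * δ₀ * g.dist y y')) * (ssup (divBη T U η A₂) + (g.len y')⁻¹ * bsup A₂) :=
  ineq3131_assembled T U blk hU τ hη d P A₁ A₂ y y' hd hsym htri hrow h260 hαδ hσ hL hge hRM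
    (ρ := 1 / 2 * δ₀) (by linarith) (by linarith) hA₁ hA₂ (bsup_nonneg A₂) (fun μ x => norm_le_bsup A₂ μ x)
    hcJ hMa hJ hCP (ssup_nonneg _) (sl1_nonneg hη.le d _) hS0 hS0s hS1 hL0 hL0s hL1

end Assembly

end Literature.MathematicalPhysics.QuantumFieldTheory.Balaban1983to89.B9Ineq3131Assembly

end
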